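import Literature.AlgebraicGeometry.HodgeTheory.WeilClasses
import Literature.AlgebraicGeometry.HodgeTheory.HodgeConjecture
import Literature.AlgebraicGeometry.Motives.HyperbolicWeilType
import HarnessLib

/-!
# Weil classes on hyperbolic (discriminant `-1`) abelian sixfolds of Weil type (Markman 2025)

A NAMED FACT (no proof): E. Markman, *Cycles on abelian 2n-folds of Weil type from secant sheaves on
abelian n-folds*, arXiv:2502.03415 (2025) [`Markman2025SecantWeil`], **Theorem 1.5.1** (text read — v2 PDF
p. 9, lines 7–13 = v1 p. 9; "p. 7" of earlier versions of this docstring was the held corpus chunk p0007 — verbatim): "Let `d` be a positive integer. Set `K := ℚ(√-d)`. The Hodge-Weil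
classes of polarized abelian sixfolds of Weil type with complex multiplication by `K` and with
discriminant `-1` are algebraic." (Proved in §9.3 there — p. 9: "The Theorem is proved in Section 9.3" — via the semiregular secant^{⊠2}-sheaves of §§8–9 on `X × X̂`,
`X` the Jacobian of a genus-3 curve, and the Buchweitz–Flenner semiregularity theorem; also stated as
the sixfold half of arXiv:2509.23403, Thm. 1.2.)

This is the sixfold companion of `HodgeTheory/WeilClassesFourfolds`
(`Markman2025_weilClasses_algebraic_abelianFourfold`, the fourfold corollary for every discriminant),
whose module docstring records why Thm. 1.5.1 itself was NOT vendored at the time: "split Weil type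
= discriminant `-1` needs a Riemann form on `H₁(A(ℂ), ℚ)` to instantiate `Motives.weilDiscriminant`".
Since then the tree has acquired the real-carrier rendering of exactly that condition,
`Motives.IsHyperbolicWeilType A φ n h` (`Motives/HyperbolicWeilType`: a `φ^*`-stable rational
`Q_h`-Lagrangian `2n`-frame of `H¹(A(ℂ); ℂ)`, i.e. Witt index `n`, which for a polarization class `h`
is van Geemen's "`H` hyperbolic" `⟺ det H = (-1)ⁿ ∈ ℚ^×/Nm(K^×)`, LNM 1594 Lemma 5.2 and 5.4 /
Landherr; module docstring (1)–(4) there). For `n = 3`, `(-1)³ = -1`: **discriminant `-1` is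
hyperbolicity**, so the theorem is now statable on the tree's carriers with no new definition, in
the literal shape already used by the route decl
`HeckePrymWeil.HyperbolicEightfoldsSqrtMinus7` of the Hodge summit (the dimension-8, `d = 7`
analogue, for which nothing is in print: "dim ≥ 8 nothing for any K", Markman §1.2).

* `Markman2025_weilClasses_algebraic_hyperbolicSixfold : Prop` — for `d ≥ 1`, `A` a complex abelian
  variety of dimension `6` (smooth projective), `φ : A ⟶ A` with `φ ≫ φ = -(d • 𝟙 A)` (so
  `K = ℚ(√-d) ↪ End⁰(A)`, `√-d ↦ φ`), a projective embedding `ι : A.X ⟶ ℙᴺ` and a rational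
  `a ≠ 0` in `H²(ℙᴺ(ℂ); ℂ)` such that `(A, φ)` is of HYPERBOLIC Weil type for the `K`-symmetrised
  hyperplane class `h = d·ι^*a + φ^*ι^*a` (`= ±` a rational multiple of an ample `φ`-compatible
  polarization class: `ι^*a = q·L`, `L` very ample, `φ^*L` ample since `φ` is finite, and
  `φ^*(dL + φ^*L) = d(dL + φ^*L)` because `(φ ≫ φ)^* = d²` on `H²`; conversely every `φ`-compatible
  polarization class `L` is `(2d)⁻¹(dL + φ^*L)`, of this form up to `ℚ^×_{>0}`; hyperbolicity is
  insensitive to `h ↦ c h`, `isHyperbolicWeilType_smul_iff`): every rational class of Hodge type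
  `(3,3)` in `H⁶(A(ℂ); ℂ)` lying in the Weil plane `weilClassesOf A φ 3 d = E₊ ⊔ E₋`
  (`HodgeTheory/WeilClasses`: the joint eigenspaces of all `(x·𝟙 + y·φ)^*`, faithful for every `d`)
  lies in `algebraicClasses A.X 3`.

## Faithfulness to print (same conventions as the fourfold fact)

* "of Weil type" (signature `(3,3)` of `K` on `H^{1,0}`) is not a separate hypothesis: if `(A, K)` is
  of Weil type the Weil classes ARE of type `(3,3)` and the print theorem applies; if not, `E₊ = ⋀⁶V₊`
  and `E₋ = ⋀⁶V₋` have pure Hodge types `(a, 6-a) ≠ (3,3)`, a `(3,3)`-class in `E₊ ⊕ E₋` is `0`, and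
  the conclusion is trivial (`zero_mem`).
* "polarized … with discriminant `-1`": print's `(A, η, h)` carries a `K`-compatible polarization and
  `det H` is computed from it; here the polarization enters only through its rational class, in the
  symmetrised form above, and "discriminant `-1`" is rendered as `IsHyperbolicWeilType A φ 3 h`
  (dictionary (3) of `Motives/HyperbolicWeilType`: for a polarization class, `Q_h`-Lagrangian
  `φ^*`-stable rational `2n`-planes of `H¹` ↔ `K`-isotropic `n`-planes of `H₁`, Witt index `n`
  ↔ `det H = (-1)ⁿ`). Requiring `√-d ∈ End(A)` (not merely `End⁰`) and a CHOSEN embedding only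
  restricts the family — never more than print.
* `d` is any positive integer, as printed (`d` non-squarefree gives the same field `ℚ(√-d₀)` and an
  order of it acting; still "complex multiplication by `K`").
* Upper bound: the fact is an instance of the summit statement `HodgeConjectureFor`
  (`Markman2025_weilClasses_algebraic_hyperbolicSixfold_of_hodgeConjectureFor`), so nothing beyond the
  summit statement is asserted.

Consumers. Grounds (as NEAREST PRINT, one dimension lower) the crux
`HeckePrymWeil.HyperbolicEightfoldsSqrtMinus7` (stmt-HodgeConjecture-14642); at `d = 7` it IS the
settled split component of `HeckePrymWeil.WeilSixfoldsSqrtMinus7` (stmt-HodgeConjecture-1260, whose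
Hecke–Prym anchors `P(7,2)` were computed to be split); also the hyperbolic-component statements of
routes `TateCuspKLift` / `TropicalCuspLift` in dimension 6.

## References

* [Markman2025SecantWeil] E. Markman, Cycles on abelian 2n-folds of Weil type from secant sheaves
  on abelian n-folds, arXiv:2502.03415, §1.1 (discriminant), Thm. 1.5.1, §1.2 (nothing for `n ≥ 4`).
* [Markman2025SecantWeilSurvey] E. Markman, Secant sheaves and Weil classes on abelian varieties,
  arXiv:2509.23403, Thm. 1.2.
* [vanGeemen1994HodgeAV] B. van Geemen, LNM 1594 (1994), Lemma 5.2, 5.4 (Landherr), Thm. 6.12.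
-/

noncomputable section

open CategoryTheory

namespace Literature.AlgebraicGeometry.HodgeTheory

open Literature.AlgebraicTopology.SingularHomology

section HodgeTheory

/-- **Markman 2025, arXiv:2502.03415 Thm. 1.5.1: "Let `d` be a positive integer. Set `K := ℚ(√-d)`.
The Hodge-Weil classes of polarized abelian sixfolds of Weil type with complex multiplication by `K`
and with discriminant `-1` are algebraic."** Rendering (module docstring): for `d ≥ 1`, `A` a
complex abelian sixfold with `φ ≫ φ = -(d • 𝟙 A)`, a projective embedding `ι` and a rational
`a ≠ 0` in `H²(ℙᴺ(ℂ); ℂ)` with `(A, φ)` of hyperbolic Weil type (`= det H = (-1)³ = -1`) for the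
`K`-symmetrised hyperplane class `h = d·ι^*a + φ^*ι^*a`, every rational `(3,3)`-class of the Weil
plane `weilClassesOf A φ 3 d` is algebraic. A published THEOREM recorded as a named fact; it
grounds, as nearest print (dimension 6 versus 8), the route decl
`HeckePrymWeil.HyperbolicEightfoldsSqrtMinus7` of the Hodge summit.
[cite: Markman2025SecantWeil, Thm. 1.5.1] [cite: vanGeemen1994HodgeAV, Lemma 5.2 and 5.4] -/
def Markman2025_weilClasses_algebraic_hyperbolicSixfold : Prop :=
  ∀ (d : ℕ), 0 < d → ∀ (A : Motives.AbelianVariety ℂ) (φ : A ⟶ A), A.dim = 2 * 3 →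
    Motives.IsSmoothProjective (2 * 3) A.X → φ ≫ φ = -(d • 𝟙 A) →
      ∀ (e : Motives.ProjectiveEmbedding A.X)
        (a : complexBetti (Motives.projectiveSpace e.n ℂ) 2), IsRationalClass a → a ≠ 0 →
        Motives.IsHyperbolicWeilType A φ 3
          ((d : ℂ) • complexBetti.map e.ι 2 a +
            complexBetti.map φ.hom.hom.hom 2 (complexBetti.map e.ι 2 a)) →
          ∀ c : complexBetti A.X (2 * 3), IsRationalClass c →
            IsOfHodgeType (2 * 3) A.X (2 * 3) 3 3 c → c ∈ weilClassesOf A φ 3 d →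
              c ∈ algebraicClasses A.X 3

/-! ### Upper bound: the fact is an instance of the Hodge conjecture -/

/-- `HodgeConjectureFor` for all smooth projective varieties implies the fact: it is its instance
over hyperbolic abelian sixfolds restricted to the Weil plane (nothing stronger than the summit
statement is claimed). [cite: Deligne2000, §1] -/
theorem Markman2025_weilClasses_algebraic_hyperbolicSixfold_of_hodgeConjectureFor
    (h : ∀ ⦃n : ℕ⦄ ⦃X : Motives.SchemeOver ℂ⦄, Motives.IsSmoothProjective n X → HodgeConjectureFor n X) :
    Markman2025_weilClasses_algebraic_hyperbolicSixfold :=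
  fun _ _ _ _ _ hX _ _ _ _ _ _ c hc h33 _ ↦ (h hX).2 3 c hc h33

/-- Sanity on the hypotheses: the zero class is a Weil class of every `(A, φ, 3, d)` and is
algebraic, so the fact is consistent on its trivially inhabited instance. [folklore] -/
theorem zero_mem_weilClassesOf_three_and_algebraicClasses (A : Motives.AbelianVariety ℂ) (φ : A ⟶ A)
    (d : ℕ) : (0 : complexBetti A.X (2 * 3)) ∈ weilClassesOf A φ 3 d ∧
      (0 : complexBetti A.X (2 * 3)) ∈ algebraicClasses A.X 3 :=
  ⟨Submodule.zero_mem _, Submodule.zero_mem _⟩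

end HodgeTheory

end Literature.AlgebraicGeometry.HodgeTheory

end
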